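import Summits.AtomisticToContinuum.HydrodynamicLimit.Theorems.ImplosionDichotomyHydroLimitInBandOfHeart
import HarnessLib

/-!
# The ledger end, D-shape (stub `stub_ledgerEndD`, line `Sketch`, crux `ClampedTransferDock`, stmt-17615)

Support file (`--supports stmt-AtomisticToContinuum-17615`) proving the registered stub `stub_ledgerEndD : LedgerEndD` of the
skeleton `Cruxes/ClampedTransferDock/Lines/Sketch.lean` (v3, §3): the def re-declared verbatim, its first antecedent
`OneWindowLedgerStaticD` (not a registered signature) inlined as text; the other antecedents / the consequent are the landed
`ClampedCurrentsDockFromWindows.{WindowContinuityInBand, LedgerAprioriBound}` and `HydroLimitInBandOfHeart.GronwallCoreInBand`.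
QUANTIFIER PLUMBING ONLY — the two landed templates re-run in the D-shape `∀ δ ∃ K ∃ ε`:
* `ledgerIntegratedD` is the D-shape twin of `ClampedCurrentsDockFromWindows.stub_ledgerFromWindowsS` (summation of the one-window
  ledger with the static telescoping, Yau 1991 §2; proof adapted verbatim, its generic real-analysis lemma `integrated_of_windows`
  reused as is): given `δ`, the D-window clause supplies `K, ε` with `4(1+t) ε e^{2Kt} ≤ δ`, then `τ, N₀`; the statics clause and
  the window continuity are invoked at that same `ε`, and the output rate / accuracy are `2K`, `4(1+t) ε`;
* `stub_ledgerEndD` is the D-shape twin of `HydroLimitInBandOfHeart.gronwallCoreInBand_of_ledger` (running-supremum Grönwall end;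
  proof adapted verbatim): for a target `δ` the integrated D-ledger at `δ/2` gives `K, ε` with `ε e^{Kt} ≤ δ/2` and
  `ClampedCurrentsDockLedgerGlue.le_mul_exp_of_integral_sSup` gives `H_N(t) ≤ (N+1) ε e^{Kt} ≤ (N+1) δ/2`.
prover-line-stmt-AtomisticToContinuum-17615-0 (stub worker `stub_ledgerEndD`).
-/

noncomputable section

open MeasureTheory Filter Set Topology InformationTheory
open scoped ENNReal

namespace Summit.AtomisticToContinuum.HydrodynamicLimit.Theorems.ClampedTransferDockLedgerEndD

open Literature.MathematicalPhysics.KineticTheory Literature.Analysis.FluidPDE Literature.Analysis.FunctionSpaces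
open Summit.AtomisticToContinuum.HydrodynamicLimit.Theses
open Summit.AtomisticToContinuum.HydrodynamicLimit.Theses.OneFlightGossipEngine
open Summit.AtomisticToContinuum.HydrodynamicLimit.Theorems
open Summit.AtomisticToContinuum.HydrodynamicLimit.Theorems.HydroLimitInBandOfHeart (GronwallCoreInBand)
open Summit.AtomisticToContinuum.HydrodynamicLimit.Theorems.ClampedCurrentsDockFromWindows
  (LedgerAprioriBound WindowContinuityInBand integrated_of_windows)

/-! ## §1 The statement (verbatim from the line skeleton v3, `OneWindowLedgerStaticD` inlined) -/

/-- registered stub signature `stub_ledgerEndD` of line Sketch, crux ClampedTransferDock (stmt-AtomisticToContinuum-17615) — route-internal, not a cited fact -/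
def LedgerEndD : Prop :=
  (∀ (r : ℝ) (Rf : ℝ → ℝ), 0 < r →
    (∃ p : FormalMultilinearSeries ℝ ℝ ℝ, HasFPowerSeriesOnBall Rf p 0 (ENNReal.ofReal r)) →
    (∃ L : NNReal, LipschitzOnWith L Rf (Icc 0 r)) →
    (∀ x ∈ Ioo (-r) r, 0 < Rf x ∧ Rf x * (∑' j : ℕ, bE j / (j.factorial : ℝ) * (x * Rf x) ^ j) = 1) →
    (∀ x ∈ Icc 0 r, 1 ≤ Rf x ∧ Rf x ≤ 2) → ContinuousOn Rf (Icc 0 r) →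
    (∀ x ∈ Ioo (-r) r, ∀ R ∈ Icc (1 / 2 : ℝ) 2,
      R * (∑' j : ℕ, bE j / (j.factorial : ℝ) * (x * R) ^ j) = 1 → R = Rf x) →
    ∀ η₀ : ℝ, 0 < η₀ →
    (∀ (a θ₀ : T3 → ℝ) (u₀ : T3 → V3), Continuous a → Continuous θ₀ → Continuous u₀ → (∀ x, 0 < a x) →
      (∀ x, 0 < θ₀ x) → ∀ σ : ℝ, 0 < σ → σ ^ 3 * (⨆ x, a x) ≤ η₀ * ∫ x, a x →
      ∃ ρ₀ : T3 → ℝ, Continuous ρ₀ ∧ (∀ x, 0 < ρ₀ x) ∧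
        (∀ (N : ℕ) (Φ : HardSphereFlow (Torus.geometry (Fin 3)) (hsDiameter σ N) (N + 1)),
          IsProbabilityMeasure (localGibbsLaw σ a u₀ θ₀ N Φ)) ∧
        ∀ χ : T3 → ℝ, Continuous χ → ∀ δ : ℝ, 0 < δ → ∃ C : ℝ, 0 < C ∧
          ∀ (N : ℕ) (Φ : HardSphereFlow (Torus.geometry (Fin 3)) (hsDiameter σ N) (N + 1)),
            localGibbsLaw σ a u₀ θ₀ N Φ {z | δ < |empiricalDensityField z χ - ∫ x, χ x * ρ₀ x|} ≤
                ENNReal.ofReal (C * Real.exp (-(C⁻¹ * ((N : ℝ) + 1)))) ∧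
              localGibbsLaw σ a u₀ θ₀ N Φ
                  {z | δ < ‖empiricalMomentumField z χ - ∫ x, (χ x * ρ₀ x) • u₀ x‖} ≤
                ENNReal.ofReal (C * Real.exp (-(C⁻¹ * ((N : ℝ) + 1)))) ∧
              localGibbsLaw σ a u₀ θ₀ N Φ {z | δ < |empiricalEnergyField z χ -
                  ∫ x, χ x * totalEnergyDensity (ρ₀ x) (u₀ x) (θ₀ x)|} ≤
                ENNReal.ofReal (C * Real.exp (-(C⁻¹ * ((N : ℝ) + 1))))) →
    ∃ ηp : ℝ, 0 < ηp ∧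
    ∀ (a₀ θ₀ : T3 → ℝ) (u₀ : T3 → V3), Continuous a₀ → Continuous θ₀ → Continuous u₀ →
      (∀ x, 0 < a₀ x) → (∀ x, 0 < θ₀ x) →
      ∃ σ₀ : ℝ, 0 < σ₀ ∧ ∀ σ : ℝ, 0 < σ → σ < σ₀ →
        ∀ (T : ℝ) (ρ θ : ℝ → T3 → ℝ) (u : ℝ → T3 → V3), IsHardSphereEulerSolution σ T ρ u θ →
          (∀ s ∈ Set.Ico 0 T, ∀ x, ρ s x * σ ^ 3 < ηp) →
          ∀ Φ : (N : ℕ) → HardSphereFlow (Torus.geometry (Fin 3)) (hsDiameter σ N) (N + 1),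
            TendstoHydroFieldsAt (fun N => localGibbsLaw σ a₀ u₀ θ₀ N (Φ N)) Φ ρ u θ 0 →
            ∀ t ∈ Set.Ioo 0 T,
              ∃ Cst : ℝ → ℝ, ContinuousOn Cst (Set.Icc 0 t) ∧
                (∀ ε : ℝ, 0 < ε → ∃ N₀ : ℕ, ∀ N : ℕ, N₀ ≤ N → ∀ t' ∈ Set.Icc 0 t,
                  |Real.log (posPartition (fun x => ρ t' x * Rf (σ ^ 3 * ρ t' x)) (hsDiameter σ N) (N + 1)) -
                      Real.log (posPartition (fun x => ρ 0 x * Rf (σ ^ 3 * ρ 0 x)) (hsDiameter σ N) (N + 1)) +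
                    ((N : ℝ) + 1) * ∫ r in (0 : ℝ)..t', Cst r| ≤ ((N : ℝ) + 1) * ε) ∧
                ∀ δ : ℝ, 0 < δ → ∃ K : ℝ, 0 ≤ K ∧ ∃ ε : ℝ, 0 < ε ∧ 4 * (1 + t) * ε * Real.exp (2 * K * t) ≤ δ ∧
                ∃ τ : ℝ, 0 < τ ∧ ∃ N₀ : ℕ, ∀ N : ℕ, N₀ ≤ N →
                ∀ s : ℝ, 0 ≤ s → s + τ * ((N : ℝ) + 1) ^ (-(1 / 3 : ℝ)) ≤ t →
                (klDiv ((Φ N).lawAt (localGibbsLaw σ a₀ u₀ θ₀ N (Φ N)) (s + τ * ((N : ℝ) + 1) ^ (-(1 / 3 : ℝ))))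
                  (localGibbsLaw σ (fun x => ρ (s + τ * ((N : ℝ) + 1) ^ (-(1 / 3 : ℝ))) x *
                      Rf (σ ^ 3 * ρ (s + τ * ((N : ℝ) + 1) ^ (-(1 / 3 : ℝ))) x))
                    (u (s + τ * ((N : ℝ) + 1) ^ (-(1 / 3 : ℝ)))) (θ (s + τ * ((N : ℝ) + 1) ^ (-(1 / 3 : ℝ))))
                    N (Φ N))).toReal ≤
                (klDiv ((Φ N).lawAt (localGibbsLaw σ a₀ u₀ θ₀ N (Φ N)) s)
                  (localGibbsLaw σ (fun x => ρ s x * Rf (σ ^ 3 * ρ s x)) (u s) (θ s) N (Φ N))).toReal +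
                K * (τ * ((N : ℝ) + 1) ^ (-(1 / 3 : ℝ))) *
                  sSup ((fun s' => (klDiv ((Φ N).lawAt (localGibbsLaw σ a₀ u₀ θ₀ N (Φ N)) s')
                    (localGibbsLaw σ (fun x => ρ s' x * Rf (σ ^ 3 * ρ s' x)) (u s') (θ s') N (Φ N))).toReal) ''
                    Set.Icc 0 (s + τ * ((N : ℝ) + 1) ^ (-(1 / 3 : ℝ)))) +
                (τ * ((N : ℝ) + 1) ^ (-(1 / 3 : ℝ))) * ((N : ℝ) + 1) * ε +
                ((Real.log (posPartition (fun x => ρ (s + τ * ((N : ℝ) + 1) ^ (-(1 / 3 : ℝ))) x *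
                      Rf (σ ^ 3 * ρ (s + τ * ((N : ℝ) + 1) ^ (-(1 / 3 : ℝ))) x)) (hsDiameter σ N) (N + 1)) -
                    Real.log (posPartition (fun x => ρ s x * Rf (σ ^ 3 * ρ s x)) (hsDiameter σ N) (N + 1))) +
                  (τ * ((N : ℝ) + 1) ^ (-(1 / 3 : ℝ))) * ((N : ℝ) + 1) * Cst s)) →
    WindowContinuityInBand → LedgerAprioriBound → GronwallCoreInBand

/-! ## §2 Step 1: the integrated ledger in band, D-shape (twin of `stub_ledgerFromWindowsS`) -/

/-- **The D-shape one-window ledger with the static telescoping, the window continuity and the a-priori bound imply the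
integrated ledger in band, D-shape** (the skeleton's `LedgerIntegratedCoreInBandD`, inlined: tail
`∀ δ ∃ K ≥ 0 ∃ ε > 0, ε e^{Kt} ≤ δ ∧ ∃ N₀ ∀ N ≥ N₀ ∀ t′ ∈ [0,t], H_N(t′) ≤ (N+1) ε + K ∫₀^{t′} sup_{[0,r]} H_N`).
`ηp := min ηp₁ (r/2)`, `σ₀ := min σ₁ (min σ₂ (min σ_z (1/2)))` (`σ_z`: `QuenchedCellClock.stub_timeZeroReference`, so
`H_N(0) = 0`); given `δ`, the D-window clause AT `δ` fixes `K, ε, τ, N₁`; the statics clause, the window continuity at `τ` and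
the modulus of `Cst` on `[0, t]` run at that `ε`; `K w_N ≤ 1/2` eventually; `integrated_of_windows` at fixed `N` gives
`H_N(t′) ≤ (N+1)·4(1+t) ε + 2K ∫₀^{t′} sup H_N`, i.e. the D-conclusion with `K′ := 2K`, `ε′ := 4(1+t) ε`,
`ε′ e^{K′t} = 4(1+t) ε e^{2Kt} ≤ δ`. (Yau's bookkeeping; adapted verbatim from the landed
`ClampedCurrentsDockFromWindows.stub_ledgerFromWindowsS`.) -/
theorem ledgerIntegratedD
    (hW : ∀ (r : ℝ) (Rf : ℝ → ℝ), 0 < r →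
      (∃ p : FormalMultilinearSeries ℝ ℝ ℝ, HasFPowerSeriesOnBall Rf p 0 (ENNReal.ofReal r)) →
      (∃ L : NNReal, LipschitzOnWith L Rf (Icc 0 r)) →
      (∀ x ∈ Ioo (-r) r, 0 < Rf x ∧ Rf x * (∑' j : ℕ, bE j / (j.factorial : ℝ) * (x * Rf x) ^ j) = 1) →
      (∀ x ∈ Icc 0 r, 1 ≤ Rf x ∧ Rf x ≤ 2) → ContinuousOn Rf (Icc 0 r) →
      (∀ x ∈ Ioo (-r) r, ∀ R ∈ Icc (1 / 2 : ℝ) 2,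
        R * (∑' j : ℕ, bE j / (j.factorial : ℝ) * (x * R) ^ j) = 1 → R = Rf x) →
      ∀ η₀ : ℝ, 0 < η₀ →
      (∀ (a θ₀ : T3 → ℝ) (u₀ : T3 → V3), Continuous a → Continuous θ₀ → Continuous u₀ → (∀ x, 0 < a x) →
        (∀ x, 0 < θ₀ x) → ∀ σ : ℝ, 0 < σ → σ ^ 3 * (⨆ x, a x) ≤ η₀ * ∫ x, a x →
        ∃ ρ₀ : T3 → ℝ, Continuous ρ₀ ∧ (∀ x, 0 < ρ₀ x) ∧
          (∀ (N : ℕ) (Φ : HardSphereFlow (Torus.geometry (Fin 3)) (hsDiameter σ N) (N + 1)),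
            IsProbabilityMeasure (localGibbsLaw σ a u₀ θ₀ N Φ)) ∧
          ∀ χ : T3 → ℝ, Continuous χ → ∀ δ : ℝ, 0 < δ → ∃ C : ℝ, 0 < C ∧
            ∀ (N : ℕ) (Φ : HardSphereFlow (Torus.geometry (Fin 3)) (hsDiameter σ N) (N + 1)),
              localGibbsLaw σ a u₀ θ₀ N Φ {z | δ < |empiricalDensityField z χ - ∫ x, χ x * ρ₀ x|} ≤
                  ENNReal.ofReal (C * Real.exp (-(C⁻¹ * ((N : ℝ) + 1)))) ∧
                localGibbsLaw σ a u₀ θ₀ N Φ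
                    {z | δ < ‖empiricalMomentumField z χ - ∫ x, (χ x * ρ₀ x) • u₀ x‖} ≤
                  ENNReal.ofReal (C * Real.exp (-(C⁻¹ * ((N : ℝ) + 1)))) ∧
                localGibbsLaw σ a u₀ θ₀ N Φ {z | δ < |empiricalEnergyField z χ -
                    ∫ x, χ x * totalEnergyDensity (ρ₀ x) (u₀ x) (θ₀ x)|} ≤
                  ENNReal.ofReal (C * Real.exp (-(C⁻¹ * ((N : ℝ) + 1))))) →
      ∃ ηp : ℝ, 0 < ηp ∧
      ∀ (a₀ θ₀ : T3 → ℝ) (u₀ : T3 → V3), Continuous a₀ → Continuous θ₀ → Continuous u₀ →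
        (∀ x, 0 < a₀ x) → (∀ x, 0 < θ₀ x) →
        ∃ σ₀ : ℝ, 0 < σ₀ ∧ ∀ σ : ℝ, 0 < σ → σ < σ₀ →
          ∀ (T : ℝ) (ρ θ : ℝ → T3 → ℝ) (u : ℝ → T3 → V3), IsHardSphereEulerSolution σ T ρ u θ →
            (∀ s ∈ Set.Ico 0 T, ∀ x, ρ s x * σ ^ 3 < ηp) →
            ∀ Φ : (N : ℕ) → HardSphereFlow (Torus.geometry (Fin 3)) (hsDiameter σ N) (N + 1),
              TendstoHydroFieldsAt (fun N => localGibbsLaw σ a₀ u₀ θ₀ N (Φ N)) Φ ρ u θ 0 →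
              ∀ t ∈ Set.Ioo 0 T,
                ∃ Cst : ℝ → ℝ, ContinuousOn Cst (Set.Icc 0 t) ∧
                  (∀ ε : ℝ, 0 < ε → ∃ N₀ : ℕ, ∀ N : ℕ, N₀ ≤ N → ∀ t' ∈ Set.Icc 0 t,
                    |Real.log (posPartition (fun x => ρ t' x * Rf (σ ^ 3 * ρ t' x)) (hsDiameter σ N) (N + 1)) -
                        Real.log (posPartition (fun x => ρ 0 x * Rf (σ ^ 3 * ρ 0 x)) (hsDiameter σ N) (N + 1)) +
                      ((N : ℝ) + 1) * ∫ r in (0 : ℝ)..t', Cst r| ≤ ((N : ℝ) + 1) * ε) ∧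
                  ∀ δ : ℝ, 0 < δ → ∃ K : ℝ, 0 ≤ K ∧ ∃ ε : ℝ, 0 < ε ∧ 4 * (1 + t) * ε * Real.exp (2 * K * t) ≤ δ ∧
                  ∃ τ : ℝ, 0 < τ ∧ ∃ N₀ : ℕ, ∀ N : ℕ, N₀ ≤ N →
                  ∀ s : ℝ, 0 ≤ s → s + τ * ((N : ℝ) + 1) ^ (-(1 / 3 : ℝ)) ≤ t →
                  (klDiv ((Φ N).lawAt (localGibbsLaw σ a₀ u₀ θ₀ N (Φ N)) (s + τ * ((N : ℝ) + 1) ^ (-(1 / 3 : ℝ))))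
                    (localGibbsLaw σ (fun x => ρ (s + τ * ((N : ℝ) + 1) ^ (-(1 / 3 : ℝ))) x *
                        Rf (σ ^ 3 * ρ (s + τ * ((N : ℝ) + 1) ^ (-(1 / 3 : ℝ))) x))
                      (u (s + τ * ((N : ℝ) + 1) ^ (-(1 / 3 : ℝ)))) (θ (s + τ * ((N : ℝ) + 1) ^ (-(1 / 3 : ℝ))))
                      N (Φ N))).toReal ≤
                  (klDiv ((Φ N).lawAt (localGibbsLaw σ a₀ u₀ θ₀ N (Φ N)) s)
                    (localGibbsLaw σ (fun x => ρ s x * Rf (σ ^ 3 * ρ s x)) (u s) (θ s) N (Φ N))).toReal +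
                  K * (τ * ((N : ℝ) + 1) ^ (-(1 / 3 : ℝ))) *
                    sSup ((fun s' => (klDiv ((Φ N).lawAt (localGibbsLaw σ a₀ u₀ θ₀ N (Φ N)) s')
                      (localGibbsLaw σ (fun x => ρ s' x * Rf (σ ^ 3 * ρ s' x)) (u s') (θ s') N (Φ N))).toReal) ''
                      Set.Icc 0 (s + τ * ((N : ℝ) + 1) ^ (-(1 / 3 : ℝ)))) +
                  (τ * ((N : ℝ) + 1) ^ (-(1 / 3 : ℝ))) * ((N : ℝ) + 1) * ε +
                  ((Real.log (posPartition (fun x => ρ (s + τ * ((N : ℝ) + 1) ^ (-(1 / 3 : ℝ))) x *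
                        Rf (σ ^ 3 * ρ (s + τ * ((N : ℝ) + 1) ^ (-(1 / 3 : ℝ))) x)) (hsDiameter σ N) (N + 1)) -
                      Real.log (posPartition (fun x => ρ s x * Rf (σ ^ 3 * ρ s x)) (hsDiameter σ N) (N + 1))) +
                    (τ * ((N : ℝ) + 1) ^ (-(1 / 3 : ℝ))) * ((N : ℝ) + 1) * Cst s))
    (hWC : WindowContinuityInBand) (hA : LedgerAprioriBound) :
    ∀ (r : ℝ) (Rf : ℝ → ℝ), 0 < r →
      (∃ p : FormalMultilinearSeries ℝ ℝ ℝ, HasFPowerSeriesOnBall Rf p 0 (ENNReal.ofReal r)) →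
      (∃ L : NNReal, LipschitzOnWith L Rf (Icc 0 r)) →
      (∀ x ∈ Ioo (-r) r, 0 < Rf x ∧ Rf x * (∑' j : ℕ, bE j / (j.factorial : ℝ) * (x * Rf x) ^ j) = 1) →
      (∀ x ∈ Icc 0 r, 1 ≤ Rf x ∧ Rf x ≤ 2) → ContinuousOn Rf (Icc 0 r) →
      (∀ x ∈ Ioo (-r) r, ∀ R ∈ Icc (1 / 2 : ℝ) 2,
        R * (∑' j : ℕ, bE j / (j.factorial : ℝ) * (x * R) ^ j) = 1 → R = Rf x) →
      ∀ η₀ : ℝ, 0 < η₀ →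
      (∀ (a θ₀ : T3 → ℝ) (u₀ : T3 → V3), Continuous a → Continuous θ₀ → Continuous u₀ → (∀ x, 0 < a x) →
        (∀ x, 0 < θ₀ x) → ∀ σ : ℝ, 0 < σ → σ ^ 3 * (⨆ x, a x) ≤ η₀ * ∫ x, a x →
        ∃ ρ₀ : T3 → ℝ, Continuous ρ₀ ∧ (∀ x, 0 < ρ₀ x) ∧
          (∀ (N : ℕ) (Φ : HardSphereFlow (Torus.geometry (Fin 3)) (hsDiameter σ N) (N + 1)),
            IsProbabilityMeasure (localGibbsLaw σ a u₀ θ₀ N Φ)) ∧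
          ∀ χ : T3 → ℝ, Continuous χ → ∀ δ : ℝ, 0 < δ → ∃ C : ℝ, 0 < C ∧
            ∀ (N : ℕ) (Φ : HardSphereFlow (Torus.geometry (Fin 3)) (hsDiameter σ N) (N + 1)),
              localGibbsLaw σ a u₀ θ₀ N Φ {z | δ < |empiricalDensityField z χ - ∫ x, χ x * ρ₀ x|} ≤
                  ENNReal.ofReal (C * Real.exp (-(C⁻¹ * ((N : ℝ) + 1)))) ∧
                localGibbsLaw σ a u₀ θ₀ N Φ
                    {z | δ < ‖empiricalMomentumField z χ - ∫ x, (χ x * ρ₀ x) • u₀ x‖} ≤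
                  ENNReal.ofReal (C * Real.exp (-(C⁻¹ * ((N : ℝ) + 1)))) ∧
                localGibbsLaw σ a u₀ θ₀ N Φ {z | δ < |empiricalEnergyField z χ -
                    ∫ x, χ x * totalEnergyDensity (ρ₀ x) (u₀ x) (θ₀ x)|} ≤
                  ENNReal.ofReal (C * Real.exp (-(C⁻¹ * ((N : ℝ) + 1))))) →
      ∃ ηp : ℝ, 0 < ηp ∧
      ∀ (a₀ θ₀ : T3 → ℝ) (u₀ : T3 → V3), Continuous a₀ → Continuous θ₀ → Continuous u₀ →
        (∀ x, 0 < a₀ x) → (∀ x, 0 < θ₀ x) →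
        ∃ σ₀ : ℝ, 0 < σ₀ ∧ ∀ σ : ℝ, 0 < σ → σ < σ₀ →
          ∀ (T : ℝ) (ρ θ : ℝ → T3 → ℝ) (u : ℝ → T3 → V3), IsHardSphereEulerSolution σ T ρ u θ →
            (∀ s ∈ Set.Ico 0 T, ∀ x, ρ s x * σ ^ 3 < ηp) →
            ∀ Φ : (N : ℕ) → HardSphereFlow (Torus.geometry (Fin 3)) (hsDiameter σ N) (N + 1),
              TendstoHydroFieldsAt (fun N => localGibbsLaw σ a₀ u₀ θ₀ N (Φ N)) Φ ρ u θ 0 →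
              ∀ t ∈ Set.Ioo 0 T,
                ∀ δ : ℝ, 0 < δ → ∃ K : ℝ, 0 ≤ K ∧ ∃ ε : ℝ, 0 < ε ∧ ε * Real.exp (K * t) ≤ δ ∧
                  ∃ N₀ : ℕ, ∀ N : ℕ, N₀ ≤ N → ∀ t' ∈ Set.Icc 0 t,
                  (klDiv ((Φ N).lawAt (localGibbsLaw σ a₀ u₀ θ₀ N (Φ N)) t')
                    (localGibbsLaw σ (fun x => ρ t' x * Rf (σ ^ 3 * ρ t' x)) (u t') (θ t') N (Φ N))).toReal ≤
                  ((N : ℝ) + 1) * ε + K * ∫ r in (0 : ℝ)..t',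
                    sSup ((fun s => (klDiv ((Φ N).lawAt (localGibbsLaw σ a₀ u₀ θ₀ N (Φ N)) s)
                      (localGibbsLaw σ (fun x => ρ s x * Rf (σ ^ 3 * ρ s x)) (u s) (θ s) N (Φ N))).toReal) ''
                      Set.Icc 0 r) := by
  intro r Rf hr hps hLip hsol hbd hcont huniq η₀ hη₀ HU
  obtain ⟨ηp₁, hηp₁, H1p⟩ := hW r Rf hr hps hLip hsol hbd hcont huniq η₀ hη₀ HU
  refine ⟨min ηp₁ (r / 2), lt_min hηp₁ (half_pos hr), fun a₀ θ₀ u₀ ha hθ hu ha0 hθ0 => ?_⟩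
  obtain ⟨σ₁, hσ₁, H1⟩ := H1p a₀ θ₀ u₀ ha hθ hu ha0 hθ0
  obtain ⟨σ₂, hσ₂, H2⟩ := hWC r Rf hr hbd hLip a₀ θ₀ u₀ ha hθ hu ha0 hθ0
  obtain ⟨σ₃, hσ₃, H3⟩ := QuenchedCellClock.stub_timeZeroReference hr hsol hbd hcont huniq a₀ θ₀ u₀ ha hθ hu ha0 hθ0
  refine ⟨min σ₁ (min σ₂ (min σ₃ (1 / 2))), lt_min hσ₁ (lt_min hσ₂ (lt_min hσ₃ (by norm_num))), ?_⟩
  intro σ hσ hσlt T ρ θ u hEul hguard Φ htie t ht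
  simp only [lt_min_iff] at hσlt
  obtain ⟨hσ1, hσ2, hσ3, hσh⟩ := hσlt
  have hguard₁ : ∀ s ∈ Set.Ico 0 T, ∀ x, ρ s x * σ ^ 3 < ηp₁ := fun s hs x =>
    (hguard s hs x).trans_le (min_le_left _ _)
  have hpack : ∀ s ∈ Set.Icc 0 t, ∀ x, ρ s x * σ ^ 3 < r := fun s hs x =>
    ((hguard s ⟨hs.1, hs.2.trans_lt ht.2⟩ x).trans_le (min_le_right _ _)).trans (half_lt_self hr)
  obtain ⟨Cst, hCst, hstat, hwin⟩ := H1 σ hσ hσ1 T ρ θ u hEul hguard₁ Φ htie t ht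
  have hcw := H2 σ hσ hσ2 T ρ θ u hEul Φ htie t ht hpack
  have hlaw0 := H3 σ hσ hσ3 T ρ θ u hEul (ht.1.trans ht.2) Φ htie
  intro δ hδ
  -- the D-window clause AT `δ` fixes the rate `K`, the accuracy `ε`, the window `τ` and a threshold
  obtain ⟨K, hK, ε, hε, hεδ, τ, hτ, N₁, hN₁⟩ := hwin δ hδ
  have ht0 : 0 < t := ht.1
  refine ⟨2 * K, by positivity, 4 * (1 + t) * ε, by positivity, hεδ, ?_⟩
  obtain ⟨N₂, hN₂⟩ := hstat ε hε
  obtain ⟨N₃, hN₃⟩ := hcw τ hτ ε hε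
  -- uniform continuity of the static rate on the compact `[0, t]`; the windows shrink, `w_N = τ (N+1)^{-1/3} → 0`
  obtain ⟨δ', hδ', hUC⟩ :=
    Metric.uniformContinuousOn_iff_le.1 (isCompact_Icc.uniformContinuousOn_of_continuous hCst) ε hε
  have hwlim : Tendsto (fun N : ℕ => τ * ((N : ℝ) + 1) ^ (-(1 / 3 : ℝ))) atTop (𝓝 0) := by
    have h := ((tendsto_rpow_neg_atTop (by norm_num : (0 : ℝ) < 1 / 3)).comp
      (tendsto_atTop_add_const_right _ 1 tendsto_natCast_atTop_atTop)).const_mul τ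
    rw [mul_zero] at h
    exact h
  have hKlim := hwlim.const_mul K
  rw [mul_zero] at hKlim
  obtain ⟨N₄, hN₄⟩ := eventually_atTop.1
    ((hwlim.eventually_le_const hδ').and (hKlim.eventually_le_const (by norm_num : (0 : ℝ) < 1 / 2)))
  refine ⟨max N₁ (max N₂ (max N₃ N₄)), fun N hN t' ht' => ?_⟩
  simp only [max_le_iff] at hN
  obtain ⟨hN1, hN2, hN3, hN4⟩ := hN
  obtain ⟨hwδ, hKw⟩ := hN₄ N hN4
  obtain ⟨B, hBN⟩ := hA r Rf hr hbd hcont a₀ θ₀ u₀ ha hθ hu ha0 hθ0 σ hσ hσh T ρ θ u hEul t ht hpack N (Φ N)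
  have key := integrated_of_windows
    (H := fun s => (klDiv ((Φ N).lawAt (localGibbsLaw σ a₀ u₀ θ₀ N (Φ N)) s)
      (localGibbsLaw σ (fun x => ρ s x * Rf (σ ^ 3 * ρ s x)) (u s) (θ s) N (Φ N))).toReal)
    (L := fun s => Real.log (posPartition (fun x => ρ s x * Rf (σ ^ 3 * ρ s x)) (hsDiameter σ N) (N + 1)))
    (Cst := Cst) (t := t) (M := (N : ℝ) + 1) (K := K) (w := τ * ((N : ℝ) + 1) ^ (-(1 / 3 : ℝ))) (e := ε)
    (B := max B 0) (by positivity) hK (mul_pos hτ (Real.rpow_pos_of_pos (by positivity) _)) hε.le hKw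
    (fun s => ENNReal.toReal_nonneg)
    (fun s hs => ENNReal.toReal_le_of_le_ofReal (le_max_right _ _)
      ((hBN s hs).trans (ENNReal.ofReal_le_ofReal (le_max_left _ _))))
    (by simp only [hlaw0 N, EntropyClockDock.klDiv_lawAt_zero_localGibbsLaw hσh.le ha hθ hu ha0 hθ0 N (Φ N),
          ENNReal.toReal_zero])
    (hN₁ N hN1) (hN₂ N hN2) (hN₃ N hN3) hCst
    (fun x hx y hy hxy hyx => by
      have h := hUC y hy x hx (by rw [Real.dist_eq, abs_of_nonneg (sub_nonneg.2 hxy)]; linarith)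
      rwa [Real.dist_eq] at h)
    ht'
  exact key

/-! ## §3 Step 2: the stub (twin of `gronwallCoreInBand_of_ledger`) -/

/-- **STUB `stub_ledgerEndD` of line `Sketch` (crux `ClampedTransferDock`, stmt-17615): the D-shape one-window ledger, the
window continuity and the a-priori bound imply the guarded Grönwall core.** Through `ledgerIntegratedD`, then verbatim the landed
`HydroLimitInBandOfHeart.gronwallCoreInBand_of_ledger` with the D-shape quantifiers: the analytic insertion factor of
`stub_eosRatioAnalytic` and the matrix of `uniformLocalGibbsConcentration_proof`; `η_c := min ηp (r/6)`,
`σ₀ := min σ_L (min σ_z (1/2))`; the landed G3 `EntropyClockDock.referenceIdentificationInBand` replaces the handed-over law by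
the explicit reference; `H_N(0) = 0` by `QuenchedCellClock.stub_timeZeroReference` + `klDiv_lawAt_zero_localGibbsLaw`; for a
target `δ` the D-ledger at `δ/2` gives `K, ε` with `ε e^{Kt} ≤ δ/2`, and the running-supremum Grönwall
`ClampedCurrentsDockLedgerGlue.le_mul_exp_of_integral_sSup` gives `H_N(t) ≤ (N+1) ε e^{Kt} ≤ (N+1) δ/2`; `ℝ≥0∞` bookkeeping.
(Yau's relative-entropy method; adapted verbatim from the landed template.) -/
theorem stub_ledgerEndD : LedgerEndD := by
  intro hW hWC hA
  have hL := ledgerIntegratedD hW hWC hA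
  obtain ⟨r, hr, Rf, hana, -, -, hsol, hbd, hLip, huniq⟩ := Theorems.stub_eosRatioAnalytic
  have hcont : ContinuousOn Rf (Set.Icc 0 r) := by
    obtain ⟨L, hL⟩ := hLip
    exact hL.continuousOn
  obtain ⟨ηU, hηU, HU⟩ := Theorems.uniformLocalGibbsConcentration_proof
  obtain ⟨ηp, hηp, HL⟩ := hL r Rf hr hana hLip hsol hbd hcont huniq ηU hηU HU
  refine ⟨min ηp (r / 6), lt_min hηp (by positivity), fun a₀ θ₀ u₀ ha hθ hu ha0 hθ0 => ?_⟩
  obtain ⟨σL, hσL, HσL⟩ := HL a₀ θ₀ u₀ ha hθ hu ha0 hθ0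
  obtain ⟨σz, hσz, Hz⟩ :=
    QuenchedCellClock.stub_timeZeroReference hr hsol hbd hcont huniq a₀ θ₀ u₀ ha hθ hu ha0 hθ0
  refine ⟨min σL (min σz (1 / 2)), lt_min hσL (lt_min hσz (by norm_num)), ?_⟩
  intro σ hσ hσlt T ρ θ u hE hguard Φ htie t ht a hac hap hale hQs hlim
  have hσL' : σ < σL := hσlt.trans_le (min_le_left _ _)
  have hσz' : σ < σz := hσlt.trans_le ((min_le_right _ _).trans (min_le_left _ _))
  have hσ2' : σ < 1 / 2 := hσlt.trans_le ((min_le_right _ _).trans (min_le_right _ _))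
  have hσ2 : σ ≤ 1 / 2 := hσ2'.le
  have hT : 0 < T := ht.1.trans ht.2
  have htI : t ∈ Set.Ico 0 T := ⟨ht.1.le, ht.2⟩
  -- the Euler slice at time `t`
  have hρtc : Continuous (ρ t) := (hE.smooth_density.isSmooth_slice htI).continuous
  have hρtpos : ∀ x, 0 < ρ t x := hE.density_pos t htI
  -- packing from THE GUARD: `< ηp` on `[0,T)`, `< r` on `[0,t]`, and `6 σ³ sup ρ_t < r`
  have hpackp : ∀ s ∈ Set.Ico 0 T, ∀ x, ρ s x * σ ^ 3 < ηp := fun s hs x =>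
    (hguard s hs x).trans_le (min_le_left _ _)
  have hpackr : ∀ s ∈ Set.Icc 0 t, ∀ x, ρ s x * σ ^ 3 < r := fun s hs x =>
    ((hguard s ⟨hs.1, hs.2.trans_lt ht.2⟩ x).trans_le (min_le_right _ _)).trans_le (by linarith)
  have h6 : 6 * (σ ^ 3 * ⨆ x, ρ t x) < r := by
    have hbdd : BddAbove (Set.range (ρ t)) := (isCompact_range hρtc).bddAbove
    obtain ⟨xM, -, hxM⟩ := isCompact_univ.exists_isMaxOn Set.univ_nonempty hρtc.continuousOn
    have hsup : (⨆ x, ρ t x) = ρ t xM :=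
      le_antisymm (ciSup_le fun x => (isMaxOn_iff.mp hxM) x (Set.mem_univ x)) (le_ciSup hbdd xM)
    have h1 : ρ t xM * σ ^ 3 < r / 6 := (hguard t htI xM).trans_le (min_le_right _ _)
    rw [hsup, mul_comm (σ ^ 3)]
    linarith
  -- G3 (landed): the handed-over reference IS the explicit one
  have hlaw : ∀ N : ℕ, localGibbsLaw σ a (u t) (θ t) N (Φ N) =
      localGibbsLaw σ (fun x => ρ t x * Rf (σ ^ 3 * ρ t x)) (u t) (θ t) N (Φ N) := fun N =>
    (EntropyClockDock.referenceIdentificationInBand r Rf hr huniq σ hσ (ρ t) a hac hap hρtc hρtpos hale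
      hQs hlim h6 (u t) (θ t) N (Φ N)).symm
  simp only [hlaw]
  -- the D-ledger in band (its `δ`-clause is opened inside the limit) and the a-priori bound, along the explicit reference family
  have HσLt := HσL σ hσ hσL' T ρ θ u hE hpackp Φ htie t ht
  have hB : ∀ N : ℕ, ∃ B : ℝ, ∀ s ∈ Set.Icc 0 t,
      klDiv ((Φ N).lawAt (localGibbsLaw σ a₀ u₀ θ₀ N (Φ N)) s)
        (localGibbsLaw σ (fun x => ρ s x * Rf (σ ^ 3 * ρ s x)) (u s) (θ s) N (Φ N)) ≤ ENNReal.ofReal B :=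
    fun N => hA r Rf hr hbd hcont a₀ θ₀ u₀ ha hθ hu ha0 hθ0 σ hσ hσ2' T ρ θ u hE t ht hpackr N (Φ N)
  have hlaw0 := Hz σ hσ hσz' T ρ θ u hE hT Φ htie
  set H : ℕ → ℝ → ℝ := fun N s =>
    (klDiv ((Φ N).lawAt (localGibbsLaw σ a₀ u₀ θ₀ N (Φ N)) s)
      (localGibbsLaw σ (fun x => ρ s x * Rf (σ ^ 3 * ρ s x)) (u s) (θ s) N (Φ N))).toReal with hH
  have hHnn : ∀ N s, 0 ≤ H N s := fun N s => ENNReal.toReal_nonneg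
  have hH0 : ∀ N, H N 0 = 0 := by
    intro N
    simp only [hH, hlaw0 N, EntropyClockDock.klDiv_lawAt_zero_localGibbsLaw hσ2 ha hθ hu ha0 hθ0 N (Φ N),
      ENNReal.toReal_zero]
  have hreal : Tendsto (fun N : ℕ => H N t / ((N : ℝ) + 1)) atTop (𝓝 0) := by
    rw [Metric.tendsto_atTop]
    intro δ hδ
    obtain ⟨K, hK, ε, _hε, hεδ, N₀, hN₀⟩ := HσLt (δ / 2) (half_pos hδ)
    refine ⟨N₀, fun N hN => ?_⟩
    have hNpos : (0 : ℝ) < (N : ℝ) + 1 := by positivity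
    obtain ⟨B, hBN⟩ := hB N
    have hHB : ∀ s ∈ Set.Icc 0 t, H N s ≤ max B 0 := by
      intro s hs
      exact ENNReal.toReal_le_of_le_ofReal (le_max_right _ _)
        ((hBN s hs).trans (ENNReal.ofReal_le_ofReal (le_max_left _ _)))
    have hmain : H N t ≤ ((N : ℝ) + 1) * ε * Real.exp (K * t) :=
      ClampedCurrentsDockLedgerGlue.le_mul_exp_of_integral_sSup (H := H N) ht.1.le hK hHB (hH0 N)
        (fun t' ht' => hN₀ N hN t' ht')
    have hq : H N t / ((N : ℝ) + 1) ≤ δ / 2 := by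
      rw [div_le_iff₀ hNpos]
      calc H N t ≤ ((N : ℝ) + 1) * ε * Real.exp (K * t) := hmain
        _ = ((N : ℝ) + 1) * (ε * Real.exp (K * t)) := by ring
        _ ≤ ((N : ℝ) + 1) * (δ / 2) := mul_le_mul_of_nonneg_left hεδ hNpos.le
        _ = δ / 2 * ((N : ℝ) + 1) := by ring
    have hq0 : 0 ≤ H N t / ((N : ℝ) + 1) := div_nonneg (hHnn N t) hNpos.le
    rw [Real.dist_eq, sub_zero, abs_of_nonneg hq0]
    linarith
  -- back to `ℝ≥0∞`
  have hfin : ∀ N : ℕ, klDiv ((Φ N).lawAt (localGibbsLaw σ a₀ u₀ θ₀ N (Φ N)) t)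
      (localGibbsLaw σ (fun x => ρ t x * Rf (σ ^ 3 * ρ t x)) (u t) (θ t) N (Φ N)) ≠ ⊤ := by
    intro N
    obtain ⟨B, hBN⟩ := hB N
    exact ne_top_of_le_ne_top ENNReal.ofReal_ne_top (hBN t ⟨ht.1.le, le_rfl⟩)
  have hcongr : ∀ N : ℕ, klDiv ((Φ N).lawAt (localGibbsLaw σ a₀ u₀ θ₀ N (Φ N)) t)
      (localGibbsLaw σ (fun x => ρ t x * Rf (σ ^ 3 * ρ t x)) (u t) (θ t) N (Φ N)) / ((N : ℝ≥0∞) + 1) =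
      ENNReal.ofReal (H N t / ((N : ℝ) + 1)) := by
    intro N
    have hNpos : (0 : ℝ) < (N : ℝ) + 1 := by positivity
    rw [ENNReal.ofReal_div_of_pos hNpos, hH, ENNReal.ofReal_toReal (hfin N)]
    congr 1
    rw [ENNReal.ofReal_add (by positivity) zero_le_one, ENNReal.ofReal_natCast, ENNReal.ofReal_one]
  simp only [hcongr]
  rw [← ENNReal.ofReal_zero]
  exact ENNReal.tendsto_ofReal hreal

end Summit.AtomisticToContinuum.HydrodynamicLimit.Theorems.ClampedTransferDockLedgerEndD

end
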